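import Mathlib
import Summits.PneNP.PneNP.Theorems.OverlapGapAlgebraSolvableImpliesStableSectionBoost

/-!
# PneNP / OverlapGapAlgebra — `SearchHardWindow`, strong Lipschitz rung (2/3): variance and boost

Support for crux `stmt-PneNP-2460` (`Summit.PneNP.PneNP.Theses.OverlapGapAlgebra.SearchHardWindow`).
For a map `g : instances → assignments` of random `k`-SAT (`Φ : Fin m → Fin k → Fin n × Bool`) that is
`s`-Lipschitz in Hamming output under single-literal changes, the violated-clause count
`V_g Φ = #{i : ∀ j, g Φ (Φ i j).1 ≠ (Φ i j).2}` has bounded differences under whole-clause changes: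
`|V_g Φ - V_g (Φ[a ↦ cl])| ≤ 1 + k s · D Φ` (`D Φ` = maximum clause-degree; `shwLip_hamming_clauseUpdate_le`,
`shwLip_card_viol_le`, `shwLip_violated_diff_sq_le`), so Efron–Stein in counting form (`es_efronStein`,
file `OverlapGapAlgebraSolvableImpliesStableSectionBoost`) gives
`∑_Φ (V_g Φ - μ)² ≤ m · (#instances + k² s² ∑_Φ D(Φ)²)` (`shwLip_sum_sq_dev_le`); and the abstract
boost-plus-Chebyshev step `shwLip_card_gt_le_of_zeroSet`: if `V ≥ 0` vanishes on more than an
`ε`-fraction and `∑ (V - μ)² ≤ W` with `4W ≤ ε N t²`, then `#{t < V} ≤ 4W/t²`.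
No new definitions; axioms `propext`, `Classical.choice`, `Quot.sound`.
-/

set_option linter.dupNamespace false -- `Summit.PneNP.PneNP.…`: summit = sub-problem (D-0017)

namespace Summit.PneNP.PneNP.Theorems

open Finset Filter
open scoped Classical

section Lipschitz

variable {m k n : ℕ}

/-- A whole-clause change is `k` single-literal changes: an `s`-Lipschitz map (Hamming output, per
single-literal change) moves by at most `k s` under the replacement of one clause. -/
theorem shwLip_hamming_clauseUpdate_le (g : (Fin m → Fin k → Fin n × Bool) → (Fin n → Bool)) (s : ℝ)
    (hg : ∀ (Φ : Fin m → Fin k → Fin n × Bool) (a : Fin m) (b : Fin k) (ℓ : Fin n × Bool),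
      (hammingDist (g Φ) (g (Function.update Φ a (Function.update (Φ a) b ℓ))) : ℝ) ≤ s)
    (Φ : Fin m → Fin k → Fin n × Bool) (a : Fin m) (cl : Fin k → Fin n × Bool) :
    (hammingDist (g Φ) (g (Function.update Φ a cl)) : ℝ) ≤ k * s := by
  -- the chain Φ_t = Φ with the first t literals of clause a replaced
  set P : ℕ → (Fin m → Fin k → Fin n × Bool) := fun t =>
    Function.update Φ a (fun j => if (j : ℕ) < t then cl j else Φ a j) with hP
  have hP0 : P 0 = Φ := by
    simp only [hP, Nat.not_lt_zero, if_false]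
    exact Function.update_eq_self a Φ
  have hPk : P k = Function.update Φ a cl := by
    simp only [hP, Fin.is_lt, if_true]
  have hstep : ∀ t : ℕ, ∀ ht : t < k,
      P (t + 1) = Function.update (P t) a (Function.update ((P t) a) ⟨t, ht⟩ (cl ⟨t, ht⟩)) := by
    intro t ht
    simp only [hP, Function.update_self, Function.update_idem]
    congr 1
    funext j
    by_cases hj : j = ⟨t, ht⟩
    · subst hj
      simp
    · rw [Function.update_of_ne hj]
      have hjt : (j : ℕ) ≠ t := fun h => hj (Fin.ext h)
      by_cases hlt : (j : ℕ) < t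
      · simp [hlt, Nat.lt_succ_of_lt hlt]
      · have : ¬ (j : ℕ) < t + 1 := by omega
        simp [hlt, this]
  have hchain : ∀ t : ℕ, t ≤ k → (hammingDist (g Φ) (g (P t)) : ℝ) ≤ t * s := by
    intro t
    induction t with
    | zero => intro _; simp [hP0]
    | succ t ih =>
        intro ht
        have ht' : t < k := Nat.lt_of_succ_le ht
        have h1 := ih ht'.le
        have h2 := hg (P t) a ⟨t, ht'⟩ (cl ⟨t, ht'⟩)
        rw [← hstep t ht'] at h2
        have htri : (hammingDist (g Φ) (g (P (t + 1))) : ℝ)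
            ≤ hammingDist (g Φ) (g (P t)) + hammingDist (g (P t)) (g (P (t + 1))) := by
          exact_mod_cast hammingDist_triangle (g Φ) (g (P t)) (g (P (t + 1)))
        push_cast
        linarith
  have := hchain k le_rfl
  rwa [hPk] at this

/-- One-sided comparison of violated-clause counts across a one-clause change: if `Φ₁, Φ₂` agree off
clause `a` and every variable lies in at most `D` clauses `i ≠ a` of `Φ₁`, then
`#viol(σ₁, Φ₁) ≤ #viol(σ₂, Φ₂) + 1 + d_H(σ₁, σ₂) · D` — a clause `i ≠ a` violated by `σ₁` but not by
`σ₂` contains a variable where `σ₁ ≠ σ₂`. -/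
theorem shwLip_card_viol_le (σ₁ σ₂ : Fin n → Bool) (Φ₁ Φ₂ : Fin m → Fin k → Fin n × Bool) (a : Fin m)
    (hoff : ∀ i, i ≠ a → Φ₁ i = Φ₂ i) (D : ℕ)
    (hD : ∀ v : Fin n, ((univ : Finset (Fin m)).filter fun i => i ≠ a ∧ ∃ j, (Φ₁ i j).1 = v).card ≤ D) :
    ((univ : Finset (Fin m)).filter fun i => ∀ j, σ₁ (Φ₁ i j).1 ≠ (Φ₁ i j).2).card
      ≤ ((univ : Finset (Fin m)).filter fun i => ∀ j, σ₂ (Φ₂ i j).1 ≠ (Φ₂ i j).2).card + 1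
        + hammingDist σ₁ σ₂ * D := by
  set S : Finset (Fin n) := (univ : Finset (Fin n)).filter fun v => σ₁ v ≠ σ₂ v with hS
  have hScard : S.card = hammingDist σ₁ σ₂ := by
    rw [hS, hammingDist]
  set Y : Finset (Fin m) := S.biUnion fun v =>
    (univ : Finset (Fin m)).filter fun i => i ≠ a ∧ ∃ j, (Φ₁ i j).1 = v with hY
  have hsub : ((univ : Finset (Fin m)).filter fun i => ∀ j, σ₁ (Φ₁ i j).1 ≠ (Φ₁ i j).2)
      ⊆ {a} ∪ ((univ : Finset (Fin m)).filter fun i => ∀ j, σ₂ (Φ₂ i j).1 ≠ (Φ₂ i j).2) ∪ Y := by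
    intro i hi
    simp only [mem_filter, mem_univ, true_and] at hi
    rw [Finset.mem_union, Finset.mem_union, Finset.mem_singleton]
    by_cases hia : i = a
    · exact Or.inl (Or.inl hia)
    by_cases h2 : ∀ j, σ₂ (Φ₂ i j).1 ≠ (Φ₂ i j).2
    · exact Or.inl (Or.inr (by simpa using h2))
    · right
      push Not at h2
      obtain ⟨j, hj⟩ := h2
      rw [← hoff i hia] at hj
      have hv : σ₁ (Φ₁ i j).1 ≠ σ₂ (Φ₁ i j).1 := by
        rw [hj]; exact hi j
      rw [hY, Finset.mem_biUnion]
      refine ⟨(Φ₁ i j).1, ?_, ?_⟩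
      · simpa [hS] using hv
      · simp only [mem_filter, mem_univ, true_and]
        exact ⟨hia, j, rfl⟩
  have hYcard : Y.card ≤ hammingDist σ₁ σ₂ * D := by
    rw [← hScard]
    calc Y.card ≤ ∑ v ∈ S, ((univ : Finset (Fin m)).filter fun i => i ≠ a ∧ ∃ j, (Φ₁ i j).1 = v).card :=
          Finset.card_biUnion_le
      _ ≤ ∑ _v ∈ S, D := Finset.sum_le_sum fun v _ => hD v
      _ = S.card * D := by rw [Finset.sum_const, smul_eq_mul]
  calc ((univ : Finset (Fin m)).filter fun i => ∀ j, σ₁ (Φ₁ i j).1 ≠ (Φ₁ i j).2).card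
      ≤ ({a} ∪ ((univ : Finset (Fin m)).filter fun i => ∀ j, σ₂ (Φ₂ i j).1 ≠ (Φ₂ i j).2) ∪ Y).card :=
        Finset.card_le_card hsub
    _ ≤ ({a} ∪ ((univ : Finset (Fin m)).filter fun i => ∀ j, σ₂ (Φ₂ i j).1 ≠ (Φ₂ i j).2)).card + Y.card :=
        Finset.card_union_le _ _
    _ ≤ (1 + ((univ : Finset (Fin m)).filter fun i => ∀ j, σ₂ (Φ₂ i j).1 ≠ (Φ₂ i j).2).card)
          + hammingDist σ₁ σ₂ * D := by
        gcongr
        exact (Finset.card_union_le _ _).trans (by rw [Finset.card_singleton])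
    _ = _ := by ring

/-- Bounded differences of the violated-clause count under a one-clause change, for a map that is
`s`-Lipschitz per single-literal change: `(V_g Φ - V_g (Φ[a ↦ cl]))² ≤ (1 + k s · D Φ)²`,
`D Φ = max_v #{i : ∃ j, (Φ i j).1 = v}`. -/
theorem shwLip_violated_diff_sq_le (g : (Fin m → Fin k → Fin n × Bool) → (Fin n → Bool)) (s : ℝ)
    (hs : 0 ≤ s)
    (hg : ∀ (Φ : Fin m → Fin k → Fin n × Bool) (a : Fin m) (b : Fin k) (ℓ : Fin n × Bool),
      (hammingDist (g Φ) (g (Function.update Φ a (Function.update (Φ a) b ℓ))) : ℝ) ≤ s)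
    (Φ : Fin m → Fin k → Fin n × Bool) (a : Fin m) (cl : Fin k → Fin n × Bool) :
    ((((univ : Finset (Fin m)).filter fun i => ∀ j, g Φ (Φ i j).1 ≠ (Φ i j).2).card : ℝ)
      - (((univ : Finset (Fin m)).filter fun i =>
          ∀ j, g (Function.update Φ a cl) ((Function.update Φ a cl) i j).1
            ≠ ((Function.update Φ a cl) i j).2).card : ℝ)) ^ 2
      ≤ (1 + k * s * ((univ : Finset (Fin n)).sup fun v =>
          ((univ : Finset (Fin m)).filter fun i => ∃ j, (Φ i j).1 = v).card : ℕ)) ^ 2 := by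
  set Φ' := Function.update Φ a cl with hΦ'
  set D : ℕ := (univ : Finset (Fin n)).sup fun v =>
      ((univ : Finset (Fin m)).filter fun i => ∃ j, (Φ i j).1 = v).card with hDdef
  have hoff : ∀ i, i ≠ a → Φ i = Φ' i := fun i hi => by rw [hΦ', Function.update_of_ne hi]
  have hoff' : ∀ i, i ≠ a → Φ' i = Φ i := fun i hi => (hoff i hi).symm
  have hD1 : ∀ v : Fin n, ((univ : Finset (Fin m)).filter fun i => i ≠ a ∧ ∃ j, (Φ i j).1 = v).card ≤ D := by
    intro v
    calc _ ≤ ((univ : Finset (Fin m)).filter fun i => ∃ j, (Φ i j).1 = v).card :=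
          Finset.card_le_card (fun i hi => by
            simp only [mem_filter, mem_univ, true_and] at hi ⊢; exact hi.2)
      _ ≤ D := by
          rw [hDdef]
          exact Finset.le_sup (f := fun v => ((univ : Finset (Fin m)).filter
            fun i => ∃ j, (Φ i j).1 = v).card) (mem_univ v)
  have hD2 : ∀ v : Fin n, ((univ : Finset (Fin m)).filter fun i => i ≠ a ∧ ∃ j, (Φ' i j).1 = v).card ≤ D := by
    intro v
    have : ((univ : Finset (Fin m)).filter fun i => i ≠ a ∧ ∃ j, (Φ' i j).1 = v)
        = ((univ : Finset (Fin m)).filter fun i => i ≠ a ∧ ∃ j, (Φ i j).1 = v) := by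
      refine Finset.filter_congr fun i _ => ?_
      constructor
      · rintro ⟨hia, j, hj⟩; exact ⟨hia, j, by rw [← hoff' i hia]; exact hj⟩
      · rintro ⟨hia, j, hj⟩; exact ⟨hia, j, by rw [hoff' i hia]; exact hj⟩
    rw [this]; exact hD1 v
  have h12 := shwLip_card_viol_le (g Φ) (g Φ') Φ Φ' a hoff D hD1
  have h21 := shwLip_card_viol_le (g Φ') (g Φ) Φ' Φ a hoff' D hD2
  have hham : (hammingDist (g Φ) (g Φ') : ℝ) ≤ k * s := by
    rw [hΦ']; exact shwLip_hamming_clauseUpdate_le g s hg Φ a cl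
  have hham' : (hammingDist (g Φ') (g Φ) : ℝ) ≤ k * s := by rw [hammingDist_comm]; exact hham
  have hDnn : (0 : ℝ) ≤ (D : ℝ) := Nat.cast_nonneg _
  have h12R : ((((univ : Finset (Fin m)).filter fun i => ∀ j, g Φ (Φ i j).1 ≠ (Φ i j).2).card : ℕ) : ℝ)
      ≤ ((((univ : Finset (Fin m)).filter fun i => ∀ j, g Φ' (Φ' i j).1 ≠ (Φ' i j).2).card : ℕ) : ℝ)
        + 1 + ((hammingDist (g Φ) (g Φ') : ℕ) : ℝ) * ((D : ℕ) : ℝ) := by exact_mod_cast h12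
  have h21R : ((((univ : Finset (Fin m)).filter fun i => ∀ j, g Φ' (Φ' i j).1 ≠ (Φ' i j).2).card : ℕ) : ℝ)
      ≤ ((((univ : Finset (Fin m)).filter fun i => ∀ j, g Φ (Φ i j).1 ≠ (Φ i j).2).card : ℕ) : ℝ)
        + 1 + ((hammingDist (g Φ') (g Φ) : ℕ) : ℝ) * ((D : ℕ) : ℝ) := by exact_mod_cast h21
  set V1 : ℝ := ((((univ : Finset (Fin m)).filter fun i => ∀ j, g Φ (Φ i j).1 ≠ (Φ i j).2).card : ℕ) : ℝ)
  set V2 : ℝ := ((((univ : Finset (Fin m)).filter fun i => ∀ j, g Φ' (Φ' i j).1 ≠ (Φ' i j).2).card : ℕ) : ℝ)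
  have hup : V1 - V2 ≤ 1 + k * s * D := by nlinarith [mul_le_mul_of_nonneg_right hham hDnn]
  have hdown : V2 - V1 ≤ 1 + k * s * D := by nlinarith [mul_le_mul_of_nonneg_right hham' hDnn]
  have habs : |V1 - V2| ≤ 1 + k * s * D := abs_sub_le_iff.2 ⟨hup, hdown⟩
  have hnn : 0 ≤ 1 + k * s * D := by positivity
  calc (V1 - V2) ^ 2 = |V1 - V2| ^ 2 := (sq_abs _).symm
    _ ≤ (1 + k * s * D) ^ 2 := pow_le_pow_left₀ (abs_nonneg _) habs 2

/-- **Variance of the violated-clause count of a Lipschitz map (Efron–Stein).** For `1 ≤ n` and a map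
`g` that is `s`-Lipschitz per single-literal change (`0 ≤ s`):
`∑_Φ (V_g Φ - μ)² ≤ m · (#instances + k² s² · ∑_Φ D(Φ)²)`, `μ` the mean of `V_g`,
`D Φ` the maximum clause-degree. -/
theorem shwLip_sum_sq_dev_le (hn : 1 ≤ n) (g : (Fin m → Fin k → Fin n × Bool) → (Fin n → Bool))
    (s : ℝ) (hs : 0 ≤ s)
    (hg : ∀ (Φ : Fin m → Fin k → Fin n × Bool) (a : Fin m) (b : Fin k) (ℓ : Fin n × Bool),
      (hammingDist (g Φ) (g (Function.update Φ a (Function.update (Φ a) b ℓ))) : ℝ) ≤ s) :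
    ∑ Φ : Fin m → Fin k → Fin n × Bool,
        ((((univ : Finset (Fin m)).filter fun i => ∀ j, g Φ (Φ i j).1 ≠ (Φ i j).2).card : ℝ)
          - (∑ Ψ : Fin m → Fin k → Fin n × Bool,
              (((univ : Finset (Fin m)).filter fun i => ∀ j, g Ψ (Ψ i j).1 ≠ (Ψ i j).2).card : ℝ))
            / Fintype.card (Fin m → Fin k → Fin n × Bool)) ^ 2
      ≤ m * (Fintype.card (Fin m → Fin k → Fin n × Bool)
          + (k : ℝ) ^ 2 * s ^ 2 * ∑ Φ : Fin m → Fin k → Fin n × Bool,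
              (((univ : Finset (Fin n)).sup fun v =>
                ((univ : Finset (Fin m)).filter fun i => ∃ j, (Φ i j).1 = v).card : ℕ) : ℝ) ^ 2) := by
  haveI : Nonempty (Fin k → Fin n × Bool) := ⟨fun _ => (⟨0, hn⟩, true)⟩
  set f : (Fin m → Fin k → Fin n × Bool) → ℝ := fun Φ =>
    (((univ : Finset (Fin m)).filter fun i => ∀ j, g Φ (Φ i j).1 ≠ (Φ i j).2).card : ℝ) with hf
  set Dr : (Fin m → Fin k → Fin n × Bool) → ℝ := fun Φ =>
    (((univ : Finset (Fin n)).sup fun v =>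
      ((univ : Finset (Fin m)).filter fun i => ∃ j, (Φ i j).1 = v).card : ℕ) : ℝ) with hDr
  have hES := Summit.PneNP.PneNP.Cruxes.SolvableImpliesStableSection.Sketch.es_efronStein
    (C := Fin k → Fin n × Bool) m f
  have hC : (0 : ℝ) < Fintype.card (Fin k → Fin n × Bool) := by
    exact_mod_cast Fintype.card_pos
  -- bound each squared difference
  have hbd : ∀ (Φ : Fin m → Fin k → Fin n × Bool) (a : Fin m) (cl : Fin k → Fin n × Bool),
      (f Φ - f (Function.update Φ a cl)) ^ 2 ≤ (1 + k * s * Dr Φ) ^ 2 := by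
    intro Φ a cl
    simp only [hf, hDr]
    exact shwLip_violated_diff_sq_le g s hs hg Φ a cl
  have hRHS : (1 / 2 : ℝ) * ∑ a : Fin m, ∑ Φ : Fin m → Fin k → Fin n × Bool,
        ∑ cl : Fin k → Fin n × Bool, (f Φ - f (Function.update Φ a cl)) ^ 2
      ≤ (1 / 2 : ℝ) * (m * (Fintype.card (Fin k → Fin n × Bool) *
          ∑ Φ : Fin m → Fin k → Fin n × Bool, (1 + k * s * Dr Φ) ^ 2)) := by
    refine mul_le_mul_of_nonneg_left ?_ (by norm_num)
    calc ∑ a : Fin m, ∑ Φ : Fin m → Fin k → Fin n × Bool,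
          ∑ cl : Fin k → Fin n × Bool, (f Φ - f (Function.update Φ a cl)) ^ 2
        ≤ ∑ _a : Fin m, ∑ Φ : Fin m → Fin k → Fin n × Bool,
          ∑ _cl : Fin k → Fin n × Bool, (1 + k * s * Dr Φ) ^ 2 := by
          exact Finset.sum_le_sum fun a _ => Finset.sum_le_sum fun Φ _ =>
            Finset.sum_le_sum fun cl _ => hbd Φ a cl
      _ = m * (Fintype.card (Fin k → Fin n × Bool) *
          ∑ Φ : Fin m → Fin k → Fin n × Bool, (1 + k * s * Dr Φ) ^ 2) := by
          simp only [Finset.sum_const, Finset.card_univ, Fintype.card_fin, nsmul_eq_mul, Finset.mul_sum]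
  have hmain := hES.trans hRHS
  -- cancel #C and simplify (1 + x)² ≤ 2 (1 + x²)
  have hsq : ∑ Φ : Fin m → Fin k → Fin n × Bool, (1 + k * s * Dr Φ) ^ 2
      ≤ 2 * (Fintype.card (Fin m → Fin k → Fin n × Bool) + (k : ℝ) ^ 2 * s ^ 2 *
          ∑ Φ : Fin m → Fin k → Fin n × Bool, Dr Φ ^ 2) := by
    calc ∑ Φ : Fin m → Fin k → Fin n × Bool, (1 + k * s * Dr Φ) ^ 2
        ≤ ∑ Φ : Fin m → Fin k → Fin n × Bool, (2 + 2 * ((k : ℝ) ^ 2 * s ^ 2 * Dr Φ ^ 2)) :=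
          Finset.sum_le_sum fun Φ _ => by nlinarith [sq_nonneg (1 - k * s * Dr Φ)]
      _ = _ := by
          rw [Finset.sum_add_distrib, Finset.sum_const, Finset.card_univ, nsmul_eq_mul,
            ← Finset.mul_sum, ← Finset.mul_sum]
          ring
  have hcancel : ∑ Φ : Fin m → Fin k → Fin n × Bool,
        (f Φ - (∑ Ψ, f Ψ) / Fintype.card (Fin m → Fin k → Fin n × Bool)) ^ 2
      ≤ (1 / 2 : ℝ) * (m * ∑ Φ : Fin m → Fin k → Fin n × Bool, (1 + k * s * Dr Φ) ^ 2) := by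
    have := hmain
    rw [show (1 / 2 : ℝ) * (m * (Fintype.card (Fin k → Fin n × Bool) *
        ∑ Φ : Fin m → Fin k → Fin n × Bool, (1 + k * s * Dr Φ) ^ 2))
        = (Fintype.card (Fin k → Fin n × Bool) : ℝ) *
          ((1 / 2 : ℝ) * (m * ∑ Φ : Fin m → Fin k → Fin n × Bool, (1 + k * s * Dr Φ) ^ 2)) by ring]
      at this
    exact le_of_mul_le_mul_left this hC
  have hm0 : (0 : ℝ) ≤ m := Nat.cast_nonneg _
  calc _ = ∑ Φ : Fin m → Fin k → Fin n × Bool,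
          (f Φ - (∑ Ψ, f Ψ) / Fintype.card (Fin m → Fin k → Fin n × Bool)) ^ 2 := by rfl
    _ ≤ (1 / 2 : ℝ) * (m * ∑ Φ : Fin m → Fin k → Fin n × Bool, (1 + k * s * Dr Φ) ^ 2) := hcancel
    _ ≤ (1 / 2 : ℝ) * (m * (2 * (Fintype.card (Fin m → Fin k → Fin n × Bool) + (k : ℝ) ^ 2 * s ^ 2 *
          ∑ Φ : Fin m → Fin k → Fin n × Bool, Dr Φ ^ 2))) := by gcongr
    _ = _ := by simp only [hDr]; ring

end Lipschitz

section Boost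

variable {ι : Type*} [Fintype ι]

/-- **Boost + Chebyshev (counting form).** Let `V ≥ 0` on a finite type with `N` elements and mean `μ`,
with `∑ (V - μ)² ≤ W`. If `V` vanishes on a set of more than `ε N` elements and `4 W ≤ ε N t²`
(`ε, t > 0`), then `μ ≤ t/2` and hence `#{x : t < V x} ≤ 4 W / t²`. (Success on an `ε`-fraction boosts
to typical `t`-validity when the variance is `o(ε N t²)`.) -/
theorem shwLip_card_gt_le_of_zeroSet (V : ι → ℝ) (hV : ∀ x, 0 ≤ V x) (W ε t : ℝ) (hε : 0 < ε)
    (ht : 0 < t)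
    (hW : ∑ x, (V x - (∑ y, V y) / Fintype.card ι) ^ 2 ≤ W)
    (Z : Finset ι) (hZ : ∀ x ∈ Z, V x = 0) (hεZ : ε * Fintype.card ι < Z.card)
    (hsmall : 4 * W ≤ ε * Fintype.card ι * t ^ 2) :
    (((univ : Finset ι).filter fun x => t < V x).card : ℝ) ≤ 4 * W / t ^ 2 := by
  set N : ℝ := (Fintype.card ι : ℝ) with hN
  set μ : ℝ := (∑ y, V y) / N with hμ
  have hZN : (Z.card : ℝ) ≤ N := by
    rw [hN]; exact_mod_cast (Finset.card_le_univ Z)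
  have hN0 : 0 ≤ N := by rw [hN]; exact Nat.cast_nonneg _
  have hNpos : 0 < N := by
    by_contra h
    push Not at h
    have hNz : N = 0 := le_antisymm h hN0
    have hZ0 : (Z.card : ℝ) ≤ 0 := hZN.trans h
    have hZnn : (0 : ℝ) ≤ Z.card := Nat.cast_nonneg _
    rw [hNz, mul_zero] at hεZ
    linarith
  have hμnn : 0 ≤ μ := by
    rw [hμ]; exact div_nonneg (Finset.sum_nonneg fun y _ => hV y) hNpos.le
  -- Chebyshev on the zero set: #Z μ² ≤ W
  have hZμ : (Z.card : ℝ) * μ ^ 2 ≤ W := by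
    calc (Z.card : ℝ) * μ ^ 2 = ∑ x ∈ Z, (V x - μ) ^ 2 := by
          rw [Finset.sum_congr rfl fun x hx => by rw [hZ x hx]]
          simp [Finset.sum_const, nsmul_eq_mul]
      _ ≤ ∑ x, (V x - μ) ^ 2 :=
          Finset.sum_le_sum_of_subset_of_nonneg (Finset.subset_univ Z) fun x _ _ => sq_nonneg _
      _ ≤ W := hW
  -- hence μ ≤ t / 2
  have hμt : μ ≤ t / 2 := by
    have h1 : ε * N * μ ^ 2 ≤ W := by
      have : ε * N * μ ^ 2 ≤ Z.card * μ ^ 2 := mul_le_mul_of_nonneg_right hεZ.le (sq_nonneg μ)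
      exact this.trans hZμ
    have h2 : μ ^ 2 ≤ (t / 2) ^ 2 := by
      have hεN : 0 < ε * N := mul_pos hε hNpos
      have : ε * N * μ ^ 2 ≤ ε * N * (t / 2) ^ 2 := by nlinarith
      exact le_of_mul_le_mul_left this hεN
    nlinarith [h2, hμnn, ht]
  -- Chebyshev above the threshold
  set T := (univ : Finset ι).filter fun x => t < V x with hT
  have hTsum : (T.card : ℝ) * (t / 2) ^ 2 ≤ W := by
    calc (T.card : ℝ) * (t / 2) ^ 2 = ∑ _x ∈ T, (t / 2) ^ 2 := by rw [Finset.sum_const, nsmul_eq_mul]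
      _ ≤ ∑ x ∈ T, (V x - μ) ^ 2 := by
          refine Finset.sum_le_sum fun x hx => ?_
          have hx' : t < V x := by simpa [hT] using hx
          have h1 : t / 2 ≤ V x - μ := by linarith
          exact pow_le_pow_left₀ (by positivity) h1 2
      _ ≤ ∑ x, (V x - μ) ^ 2 :=
          Finset.sum_le_sum_of_subset_of_nonneg (Finset.subset_univ T) fun x _ _ => sq_nonneg _
      _ ≤ W := hW
  have ht2 : 0 < t ^ 2 := by positivity
  rw [le_div_iff₀ ht2]
  have : (T.card : ℝ) * (t / 2) ^ 2 = T.card * t ^ 2 / 4 := by ring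
  rw [this] at hTsum
  linarith

end Boost

end Summit.PneNP.PneNP.Theorems
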